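import Summits.BirchSwinnertonDyer.BirchSwinnertonDyer.Theorems.ByReductionTypeAtTwoMultTowerNS2OrderBound
import HarnessLib

/-!
# Route `ByReductionTypeAtTwo`, crux `MultUpperHalfAtTwo` (item stmt-BirchSwinnertonDyer-19922), TOWER road, NON-SPLIT rows:
# the layer-`0` order of the local tower kernel at a non-split `2`, part 8 — the `2`-primary component of the
# coinvariants `M_∞/(g−1)M_∞` of the twisted Tate module is FINITE (of order `≤ 4`), and classes versus `B = Q^ℤ·(g−1)T`

HONEST FRAMING (cell `bsd-2adic`, run/shared/lean/pub/bsd-2adic/, seat `bsd-2adic-tower-1` GEN 30, HUMAN RULINGS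
D-0036 / D-0054 / D-0074): TOOL theorems only (no definition, no named fact, no `sorry`); closes nothing by itself;
nothing booked; BSD is not proved by any of this. Eighth brick of the layer-`0` count `#𝒦_{v,0}[2^∞] = 2·c₂^{(2)}`
(R. Greenberg, LNM 1716, §3 p. 93 / §4 p. 113): the LOWER bounds are proved on the coinvariants `M_∞/(g−1)M_∞`
(`M_∞ = E(K̄_v)^{H_∞} = Ψ(T)`, BRICK 18) and moved to `𝒦_{v,n}[2^∞]` by the EXACT inflation–restriction count
`GoodOrdTower.natCard_localTowerKerPrimary_eq_coinv_atP`, which wants the `2`-primary component of the coinvariants to be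
FINITE. GEN 27's `MultTowerNS2.powTorsion_localTowerKerPrimary_le_four_nonsplitTwo` proved «every `2^k`-torsion subgroup
of the coinvariants has `≤ 4` elements» only INSIDE its proof; this file exports it and packages it.
Setting of BRICKs 15–18 (abstract: `Ψ` with kernel `Q^ℤ` and the twisted equivariance, `t`, a flip `τ₀ ∈ H_∞`, `g ∈ H_n`
fixing `t` with `κ(res g) = 2^n u_g`, the class field input `hN2` of BRICK 17).

* `finite_primaryComponent_and_natCard_le_of_forall_torsionBy` — pure algebra: if every `p^k`-torsion subgroup of `G`
  is finite with `≤ C` elements then so is the `p`-primary component of `G`;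
* `finite_torsionBy_coinvariants_and_natCard_le_four` — the `2^k`-torsion of `M_∞/(g−1)M_∞` is finite with `≤ 4`
  elements (GEN 27's representatives + «among five `2^k`-torsion data two are congruent»
  `exists_div_eq_zpow_mul_coboundary_of_five_pow`);
* `finite_primaryComponent_coinvariants_and_natCard_le_four` — hence its `2`-primary component is finite, `≤ 4`;
* `exists_div_eq_zpow_mul_coboundary_of_mk_eq_mk` — equal classes `[Ψu₁] = [Ψu₂]` ⟹ `u₁/u₂ ∈ B = Q^ℤ·(g−1)T`;
* `nsmul_mk_eq_zero_of_pow_eq_zpow_mul_coboundary` — `u^{2^k} ∈ B` ⟹ `2^k·[Ψu] = 0`;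
* `even_of_eq_zpow_mul_coboundary` — elements of `B` have EVEN exponent (`τ₀x·x = Q^a`, `x ∈ B` ⟹ `a` even).

References: R. Greenberg, LNM 1716 (1999), §3 pp. 85–93; J. Silverman, GTM 151, V.3–V.5.
-/

set_option autoImplicit false
-- the Theorems namespace of this sub repeats the summit name by design (D-0017 nested layout: Summit.<S>.<Sub>)
set_option linter.dupNamespace false

noncomputable section

open scoped Classical IntermediateField

namespace Summit.BirchSwinnertonDyer.BirchSwinnertonDyer.Theorems.MultTowerNS2LayerZero

open NumberField IsDedekindDomain Field WeierstrassCurve PadicInt Literature.NumberTheory.EllipticCurves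
  Literature.NumberTheory.EllipticCurves.ResKernel Literature.NumberTheory.GaloisRepresentations
  Summit.BirchSwinnertonDyer.BirchSwinnertonDyer.Theorems.MultTowerNS2

variable {κ : ZpExtension ℚ 2}

/-! ### Pure algebra: `p`-primary component from `p^k`-torsion bounds -/

/-- **If every `p^k`-torsion subgroup of `G` is finite with `≤ C` elements, the `p`-primary component of `G` is finite with
`≤ C` elements** (`MultTowerNS2.finite_and_natCard_le_of_forall_torsionBy_pow` applied to the primary component, whose
`p^k`-torsion injects into that of `G`). [folklore] -/
theorem finite_primaryComponent_and_natCard_le_of_forall_torsionBy {G : Type*} [AddCommGroup G] (p : ℕ) [Fact p.Prime]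
    (C : ℕ) (hk : ∀ k : ℕ, Finite {x : G // p ^ k • x = 0} ∧ Nat.card {x : G // p ^ k • x = 0} ≤ C) :
    Finite (AddCommGroup.primaryComponent G p) ∧ Nat.card (AddCommGroup.primaryComponent G p) ≤ C := by
  refine finite_and_natCard_le_of_forall_torsionBy_pow p C (fun x ↦ ?_) (fun k ↦ ?_)
  · obtain ⟨k, hk'⟩ := (AddCommGroup.mem_primaryComponent).mp x.2
    exact ⟨k, Subtype.ext (by rw [AddSubmonoidClass.coe_nsmul, hk']; rfl)⟩
  · obtain ⟨hfin, hcard⟩ := hk k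
    let ι : {x : AddCommGroup.primaryComponent G p // p ^ k • x = 0} → {x : G // p ^ k • x = 0} :=
      fun x ↦ ⟨(x.1 : G), by
        have h := congrArg (fun y : AddCommGroup.primaryComponent G p ↦ (y : G)) x.2
        simpa only [AddSubmonoidClass.coe_nsmul, ZeroMemClass.coe_zero] using h⟩
    have hι : Function.Injective ι := by
      intro a b h
      have h' := congrArg Subtype.val h
      exact Subtype.ext (Subtype.ext h')
    exact ⟨Finite.of_injective ι hι, (Nat.card_le_card_of_injective ι hι).trans hcard⟩

/-! ### The `2^k`-torsion of the coinvariants of the twisted Tate module is finite, `≤ 4` -/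

/-- **The `2^k`-torsion of `M_∞/(g−1)M_∞` is finite with at most `4` elements** (abstract setting of BRICKs 15–18: `Ψ` onto
`E(K̄_v)` with kernel `Q^ℤ` and the twisted equivariance, `−t ≠ t`, a flip `τ₀ ∈ H_∞`, `g ∈ H_n` fixing `t` with
`κ(res g) = 2^n u_g`, and the class field input `hN2` of BRICK 17). This is the body of GEN 27's
`powTorsion_localTowerKerPrimary_le_four_nonsplitTwo` before BRICK 11, exported: every class has a representative `Ψ x`,
`x ∈ T`, with `x^{2^k} ∈ B` (BRICK 18), and among five such data two are congruent
(`exists_div_eq_zpow_mul_coboundary_of_five_pow`). [cite: GreenbergLNM1716, §3 (pp. 85–93)] -/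
theorem finite_torsionBy_coinvariants_and_natCard_le_four (v : HeightOneSpectrum (𝓞 ℚ)) {W : WeierstrassCurve ℚ}
    {Ψ : Additive (AlgebraicClosure (v.adicCompletion ℚ))ˣ →+ localPoints W (v.adicCompletion ℚ)}
    {t Q : AlgebraicClosure (v.adicCompletion ℚ)} {τ₀ g : absoluteGaloisGroup (v.adicCompletion ℚ)} (n : ℕ)
    {ug : ℤ_[2]ˣ} (hug : ((κ (resGal (K := ℚ) (v.adicCompletion ℚ) g)).toAdd : ℤ_[2]) = 2 ^ n * (ug : ℤ_[2]))
    (hgn : g ∈ localSubgroup (κ.layerSubgroup n) (v.adicCompletion ℚ))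
    (ht : ∀ σ : absoluteGaloisGroup (v.adicCompletion ℚ), σ • t = t ∨ σ • t = -t) (hne : -t ≠ t) (hgt : g • t = t)
    (hτ₀ : τ₀ ∈ localSubgroup κ.kerSubgroup (v.adicCompletion ℚ)) (hτ₀t : τ₀ • t = -t)
    (hQfix : ∀ σ : absoluteGaloisGroup (v.adicCompletion ℚ), σ • Q = Q) (hQ0 : Q ≠ 0)
    (hQtor : ∀ j : ℤ, Q ^ j = 1 → j = 0)
    (hN2 : ∀ c₁ c₂ c₃ : AlgebraicClosure (v.adicCompletion ℚ), c₁ ≠ 0 → c₂ ≠ 0 → c₃ ≠ 0 →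
      (∀ h ∈ localSubgroup (κ.layerSubgroup n) (v.adicCompletion ℚ), h • c₁ = c₁) →
      (∀ h ∈ localSubgroup (κ.layerSubgroup n) (v.adicCompletion ℚ), h • c₂ = c₂) →
      (∀ h ∈ localSubgroup (κ.layerSubgroup n) (v.adicCompletion ℚ), h • c₃ = c₃) →
      ∃ f₀ : AlgebraicClosure (v.adicCompletion ℚ), f₀ ≠ 0 ∧
        (∀ h ∈ localSubgroup (κ.layerSubgroup n) (v.adicCompletion ℚ), h • t = t → h • f₀ = f₀) ∧
        (c₁ = f₀ * τ₀ • f₀ * c₂ ∨ c₁ = f₀ * τ₀ • f₀ * c₃ ∨ c₂ = f₀ * τ₀ • f₀ * c₃))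
    (hsurj : Function.Surjective Ψ)
    (hker : ∀ u : (AlgebraicClosure (v.adicCompletion ℚ))ˣ, Ψ (Additive.ofMul u) = 0 ↔
      ∃ j : ℤ, (u : AlgebraicClosure (v.adicCompletion ℚ)) = Q ^ j)
    (hequiv' : ∀ (σ : absoluteGaloisGroup (v.adicCompletion ℚ)) (w w' : (AlgebraicClosure (v.adicCompletion ℚ))ˣ),
      (w' : AlgebraicClosure (v.adicCompletion ℚ)) = σ • (w : AlgebraicClosure (v.adicCompletion ℚ)) →
        σ • Ψ (Additive.ofMul w) = (if σ • t = t then (1 : ℤ) else -1) • Ψ (Additive.ofMul w'))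
    (k : ℕ) :
    Finite {y : FixedPoints.addSubgroup (localSubgroup κ.kerSubgroup (v.adicCompletion ℚ))
        (localPoints W (v.adicCompletion ℚ)) ⧸
        (subOne (localSubgroup κ.kerSubgroup (v.adicCompletion ℚ)) (localPoints W (v.adicCompletion ℚ)) g).range //
          2 ^ k • y = 0} ∧
      Nat.card {y : FixedPoints.addSubgroup (localSubgroup κ.kerSubgroup (v.adicCompletion ℚ))
        (localPoints W (v.adicCompletion ℚ)) ⧸
        (subOne (localSubgroup κ.kerSubgroup (v.adicCompletion ℚ)) (localPoints W (v.adicCompletion ℚ)) g).range //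
          2 ^ k • y = 0} ≤ 4 := by
  set P := localPoints W (v.adicCompletion ℚ) with hP
  set M : AddSubgroup P :=
    FixedPoints.addSubgroup (localSubgroup κ.kerSubgroup (v.adicCompletion ℚ)) P with hM
  have memM : ∀ {a : P}, a ∈ M ↔ ∀ h ∈ localSubgroup κ.kerSubgroup (v.adicCompletion ℚ), h • a = a := fun {a} ↦ by
    rw [hM, FixedPoints.mem_addSubgroup]
    exact ⟨fun H h hh ↦ H ⟨h, hh⟩, fun H h ↦ H h h.2⟩
  set d : M →+ M := subOne (localSubgroup κ.kerSubgroup (v.adicCompletion ℚ)) P g with hd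
  -- every `2^k`-torsion class has a representative `Ψ x`, `x ∈ T`, with `x^{2^k} = Q^j · gz/z`, `z ∈ T`
  have hrep : ∀ y : {y : M ⧸ d.range // 2 ^ k • y = 0},
      ∃ (x z : (AlgebraicClosure (v.adicCompletion ℚ))ˣ) (a j jz : ℤ) (m : M),
        (m : M ⧸ d.range) = y.1 ∧ (m : P) = Ψ (Additive.ofMul x) ∧
        (∀ h ∈ localSubgroup κ.kerSubgroup (v.adicCompletion ℚ), h • t = t →
          h • (x : AlgebraicClosure (v.adicCompletion ℚ)) = x) ∧
        τ₀ • (x : AlgebraicClosure (v.adicCompletion ℚ)) * x = Q ^ a ∧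
        (∀ h ∈ localSubgroup κ.kerSubgroup (v.adicCompletion ℚ), h • t = t →
          h • (z : AlgebraicClosure (v.adicCompletion ℚ)) = z) ∧
        τ₀ • (z : AlgebraicClosure (v.adicCompletion ℚ)) * z = Q ^ jz ∧
        (x : AlgebraicClosure (v.adicCompletion ℚ)) ^ 2 ^ k =
          Q ^ j * (g • (z : AlgebraicClosure (v.adicCompletion ℚ)) / z) := by
    rintro ⟨y, hy⟩
    obtain ⟨m, rfl⟩ := QuotientAddGroup.mk_surjective y
    obtain ⟨x, hxm, hxL, a, hxa⟩ := exists_unit_of_mem_fixedPoints (κ := κ) v hsurj hker hequiv' hQfix hQ0 hQtor hne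
      hτ₀ hτ₀t (memM.mp m.2)
    have h2m : (2 ^ k • m : M) ∈ d.range := by
      rw [← QuotientAddGroup.eq_zero_iff]
      exact hy
    obtain ⟨w₁, hw₁⟩ := h2m
    obtain ⟨z, hzm, hzL, jz, hzj⟩ := exists_unit_of_mem_fixedPoints (κ := κ) v hsurj hker hequiv' hQfix hQ0 hQtor hne
      hτ₀ hτ₀t (memM.mp w₁.2)
    set gz : (AlgebraicClosure (v.adicCompletion ℚ))ˣ :=
      Units.mk0 (g • (z : AlgebraicClosure (v.adicCompletion ℚ))) ((smul_ne_zero_iff_ne g).mpr z.ne_zero) with hgz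
    have hgΨ : g • Ψ (Additive.ofMul z) = Ψ (Additive.ofMul gz) := by
      have h1 := hequiv' g z gz rfl
      rw [if_pos hgt, one_zsmul] at h1
      exact h1
    have h3 : Ψ (Additive.ofMul (x ^ 2 ^ k)) = Ψ (Additive.ofMul (gz * z⁻¹)) := by
      rw [ofMul_pow, map_nsmul, hxm, ofMul_mul, ofMul_inv, map_add, map_neg, ← hgΨ, hzm, ← sub_eq_add_neg]
      have h4 := congrArg (fun b : M ↦ (b : P)) hw₁
      simp only [hd, AddSubgroupClass.coe_nsmul] at h4
      exact h4.symm
    rw [tatePsi_eq_iff v hker] at h3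
    obtain ⟨j, hj⟩ := h3
    refine ⟨x, z, a, j, jz, m, rfl, hxm.symm, hxL, hxa, hzL, hzj, ?_⟩
    rw [Units.val_pow_eq_pow_val] at hj
    rw [hj, Units.val_mul, Units.val_inv_eq_inv_val, hgz, Units.val_mk0, div_eq_mul_inv]
  choose x z a j jz m hmy hmx hxL hxa hzL hzj hxk using hrep
  -- among five `2^k`-torsion classes two coincide
  have key5 : ∀ ys : Fin 5 → {y : M ⧸ d.range // 2 ^ k • y = 0}, ∃ i i' : Fin 5, i ≠ i' ∧ ys i = ys i' := by
    intro ys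
    obtain ⟨i, i', hii', cc, w₁, hw0, hwL, ⟨jw, hwj⟩, hrel⟩ :=
      exists_div_eq_zpow_mul_coboundary_of_five_pow (κ := κ) v n hug hgn ht hgt hτ₀ hτ₀t hQfix hQ0 hQtor hN2 k
        (x := fun i ↦ (x (ys i) : AlgebraicClosure (v.adicCompletion ℚ)))
        (z := fun i ↦ (z (ys i) : AlgebraicClosure (v.adicCompletion ℚ)))
        (a := fun i ↦ a (ys i)) (j := fun i ↦ j (ys i)) (jz := fun i ↦ jz (ys i))
        (fun i ↦ (x (ys i)).ne_zero) (fun i ↦ hxL (ys i)) (fun i ↦ hxa (ys i)) (fun i ↦ (z (ys i)).ne_zero)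
        (fun i ↦ hzL (ys i)) (fun i ↦ hzj (ys i)) (fun i ↦ hxk (ys i))
    refine ⟨i, i', hii', ?_⟩
    set wu : (AlgebraicClosure (v.adicCompletion ℚ))ˣ := Units.mk0 w₁ hw0 with hwu
    have hwM : Ψ (Additive.ofMul wu) ∈ M :=
      memM.mpr (apply_mem_fixedPoints (κ := κ) v hker hequiv' ht hne hτ₀ hτ₀t (x := wu)
        (fun h hh hht ↦ by rw [hwu, Units.val_mk0]; exact hwL h hh hht) (a := jw) (by rw [hwu, Units.val_mk0]; exact hwj))
    set gw : (AlgebraicClosure (v.adicCompletion ℚ))ˣ :=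
      Units.mk0 (g • w₁) ((smul_ne_zero_iff_ne g).mpr hw0) with hgw
    have hgΨ : g • Ψ (Additive.ofMul wu) = Ψ (Additive.ofMul gw) := by
      have h1 := hequiv' g wu gw (by rw [hgw, hwu, Units.val_mk0, Units.val_mk0])
      rw [if_pos hgt, one_zsmul] at h1
      exact h1
    have hdP : (d ⟨Ψ (Additive.ofMul wu), hwM⟩ : P) = g • Ψ (Additive.ofMul wu) - Ψ (Additive.ofMul wu) := rfl
    have hdiff : Ψ (Additive.ofMul (x (ys i))) - Ψ (Additive.ofMul (x (ys i'))) =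
        (d ⟨Ψ (Additive.ofMul wu), hwM⟩ : P) := by
      rw [hdP, hgΨ]
      have e1 : Ψ (Additive.ofMul (x (ys i))) - Ψ (Additive.ofMul (x (ys i'))) =
          Ψ (Additive.ofMul (x (ys i) * (x (ys i'))⁻¹)) := by
        rw [ofMul_mul, ofMul_inv, map_add, map_neg, sub_eq_add_neg]
      have e2 : Ψ (Additive.ofMul gw) - Ψ (Additive.ofMul wu) = Ψ (Additive.ofMul (gw * wu⁻¹)) := by
        rw [ofMul_mul, ofMul_inv, map_add, map_neg, sub_eq_add_neg]
      rw [e1, e2, tatePsi_eq_iff v hker]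
      refine ⟨cc, ?_⟩
      rw [Units.val_mul, Units.val_inv_eq_inv_val, Units.val_mul, Units.val_inv_eq_inv_val, hgw, hwu, Units.val_mk0,
        Units.val_mk0, ← div_eq_mul_inv, hrel, div_eq_mul_inv]
    have hmm : (m (ys i) : M ⧸ d.range) = m (ys i') := by
      rw [QuotientAddGroup.eq_iff_sub_mem]
      refine ⟨⟨Ψ (Additive.ofMul wu), hwM⟩, Subtype.ext ?_⟩
      rw [AddSubgroupClass.coe_sub, hmx, hmx]
      exact hdiff.symm
    exact Subtype.ext (by rw [← hmy (ys i), ← hmy (ys i'), hmm])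
  haveI hfin : Finite {y : M ⧸ d.range // 2 ^ k • y = 0} := by
    by_contra hinf
    rw [not_finite_iff_infinite] at hinf
    let emb := Infinite.natEmbedding {y : M ⧸ d.range // 2 ^ k • y = 0}
    obtain ⟨i, i', hii', h⟩ := key5 (fun i : Fin 5 ↦ emb i)
    exact hii' (Fin.ext (emb.injective h))
  have hcard : Nat.card {y : M ⧸ d.range // 2 ^ k • y = 0} ≤ 4 := by
    by_contra hlt
    push Not at hlt
    letI := Fintype.ofFinite {y : M ⧸ d.range // 2 ^ k • y = 0}
    rw [Nat.card_eq_fintype_card] at hlt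
    let emb : Fin 5 ↪ {y : M ⧸ d.range // 2 ^ k • y = 0} :=
      (Fin.castLEEmb hlt).trans (Fintype.equivFin _).symm.toEmbedding
    obtain ⟨i, i', hii', h⟩ := key5 emb
    exact hii' (emb.injective h)
  exact ⟨hfin, hcard⟩

/-- **The `2`-primary component of `M_∞/(g−1)M_∞` is finite with at most `4` elements** (same abstract setting).
[cite: GreenbergLNM1716, §3 (pp. 85–93)] -/
theorem finite_primaryComponent_coinvariants_and_natCard_le_four (v : HeightOneSpectrum (𝓞 ℚ))
    {W : WeierstrassCurve ℚ}
    {Ψ : Additive (AlgebraicClosure (v.adicCompletion ℚ))ˣ →+ localPoints W (v.adicCompletion ℚ)}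
    {t Q : AlgebraicClosure (v.adicCompletion ℚ)} {τ₀ g : absoluteGaloisGroup (v.adicCompletion ℚ)} (n : ℕ)
    {ug : ℤ_[2]ˣ} (hug : ((κ (resGal (K := ℚ) (v.adicCompletion ℚ) g)).toAdd : ℤ_[2]) = 2 ^ n * (ug : ℤ_[2]))
    (hgn : g ∈ localSubgroup (κ.layerSubgroup n) (v.adicCompletion ℚ))
    (ht : ∀ σ : absoluteGaloisGroup (v.adicCompletion ℚ), σ • t = t ∨ σ • t = -t) (hne : -t ≠ t) (hgt : g • t = t)
    (hτ₀ : τ₀ ∈ localSubgroup κ.kerSubgroup (v.adicCompletion ℚ)) (hτ₀t : τ₀ • t = -t)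
    (hQfix : ∀ σ : absoluteGaloisGroup (v.adicCompletion ℚ), σ • Q = Q) (hQ0 : Q ≠ 0)
    (hQtor : ∀ j : ℤ, Q ^ j = 1 → j = 0)
    (hN2 : ∀ c₁ c₂ c₃ : AlgebraicClosure (v.adicCompletion ℚ), c₁ ≠ 0 → c₂ ≠ 0 → c₃ ≠ 0 →
      (∀ h ∈ localSubgroup (κ.layerSubgroup n) (v.adicCompletion ℚ), h • c₁ = c₁) →
      (∀ h ∈ localSubgroup (κ.layerSubgroup n) (v.adicCompletion ℚ), h • c₂ = c₂) →
      (∀ h ∈ localSubgroup (κ.layerSubgroup n) (v.adicCompletion ℚ), h • c₃ = c₃) →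
      ∃ f₀ : AlgebraicClosure (v.adicCompletion ℚ), f₀ ≠ 0 ∧
        (∀ h ∈ localSubgroup (κ.layerSubgroup n) (v.adicCompletion ℚ), h • t = t → h • f₀ = f₀) ∧
        (c₁ = f₀ * τ₀ • f₀ * c₂ ∨ c₁ = f₀ * τ₀ • f₀ * c₃ ∨ c₂ = f₀ * τ₀ • f₀ * c₃))
    (hsurj : Function.Surjective Ψ)
    (hker : ∀ u : (AlgebraicClosure (v.adicCompletion ℚ))ˣ, Ψ (Additive.ofMul u) = 0 ↔
      ∃ j : ℤ, (u : AlgebraicClosure (v.adicCompletion ℚ)) = Q ^ j)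
    (hequiv' : ∀ (σ : absoluteGaloisGroup (v.adicCompletion ℚ)) (w w' : (AlgebraicClosure (v.adicCompletion ℚ))ˣ),
      (w' : AlgebraicClosure (v.adicCompletion ℚ)) = σ • (w : AlgebraicClosure (v.adicCompletion ℚ)) →
        σ • Ψ (Additive.ofMul w) = (if σ • t = t then (1 : ℤ) else -1) • Ψ (Additive.ofMul w')) :
    Finite (AddCommGroup.primaryComponent
      (FixedPoints.addSubgroup (localSubgroup κ.kerSubgroup (v.adicCompletion ℚ)) (localPoints W (v.adicCompletion ℚ)) ⧸
        (subOne (localSubgroup κ.kerSubgroup (v.adicCompletion ℚ)) (localPoints W (v.adicCompletion ℚ)) g).range) 2) ∧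
      Nat.card (AddCommGroup.primaryComponent
      (FixedPoints.addSubgroup (localSubgroup κ.kerSubgroup (v.adicCompletion ℚ)) (localPoints W (v.adicCompletion ℚ)) ⧸
        (subOne (localSubgroup κ.kerSubgroup (v.adicCompletion ℚ)) (localPoints W (v.adicCompletion ℚ)) g).range) 2) ≤ 4 :=
  haveI : Fact (Nat.Prime 2) := ⟨Nat.prime_two⟩
  finite_primaryComponent_and_natCard_le_of_forall_torsionBy 2 4 fun k ↦
    finite_torsionBy_coinvariants_and_natCard_le_four (κ := κ) v n hug hgn ht hne hgt hτ₀ hτ₀t hQfix hQ0 hQtor hN2 hsurj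
      hker hequiv' k

/-! ### Classes versus `B = Q^ℤ · (g−1)T` -/

/-- **Elements of `B` have EVEN exponent**: if `x = Qʲ·(gw/w)` with `w ≠ 0` fixed by `H_∞ ∩ Stab(t)` and `τ₀w·w = Q^{jw}`,
and `τ₀x·x = Q^a`, then `a = 2j` (the exponent of a coboundary vanishes, `flip_smul_coboundary_mul_coboundary`).
[cite: GreenbergLNM1716, §3 (pp. 87–93)] -/
theorem eq_two_mul_of_eq_zpow_mul_coboundary (v : HeightOneSpectrum (𝓞 ℚ)) {t Q : AlgebraicClosure (v.adicCompletion ℚ)}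
    {τ₀ g : absoluteGaloisGroup (v.adicCompletion ℚ)}
    (ht : ∀ σ : absoluteGaloisGroup (v.adicCompletion ℚ), σ • t = t ∨ σ • t = -t) (hgt : g • t = t)
    (hτ₀ : τ₀ ∈ localSubgroup κ.kerSubgroup (v.adicCompletion ℚ)) (hτ₀t : τ₀ • t = -t)
    (hQfix : ∀ σ : absoluteGaloisGroup (v.adicCompletion ℚ), σ • Q = Q) (hQ0 : Q ≠ 0)
    (hQtor : ∀ j : ℤ, Q ^ j = 1 → j = 0) {x w : AlgebraicClosure (v.adicCompletion ℚ)} {a j jw : ℤ}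
    (hxa : τ₀ • x * x = Q ^ a) (hw0 : w ≠ 0)
    (hwL : ∀ h ∈ localSubgroup κ.kerSubgroup (v.adicCompletion ℚ), h • t = t → h • w = w)
    (hwj : τ₀ • w * w = Q ^ jw) (hx : x = Q ^ j * (g • w / w)) : a = 2 * j := by
  haveI : (localSubgroup κ.kerSubgroup (v.adicCompletion ℚ)).Normal := by
    rw [localSubgroup_eq_comap]; exact Subgroup.Normal.comap inferInstance _
  have hN := flip_smul_coboundary_mul_coboundary ht hτ₀ hτ₀t hgt hQ0 (hQfix g) hw0 hwL hwj
  have e1 : τ₀ • x * x = Q ^ (2 * j) := by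
    rw [hx, smul_mul', smul_zpow₀', hQfix, mul_mul_mul_comm, hN, mul_one, two_mul, zpow_add₀ hQ0]
  rw [hxa] at e1
  have h2 : Q ^ (a - 2 * j) = 1 := by rw [zpow_sub₀ hQ0, e1, div_self (zpow_ne_zero _ hQ0)]
  have := hQtor _ h2
  omega

section Classes

variable (v : HeightOneSpectrum (𝓞 ℚ)) {W : WeierstrassCurve ℚ}
  {Ψ : Additive (AlgebraicClosure (v.adicCompletion ℚ))ˣ →+ localPoints W (v.adicCompletion ℚ)}
  {t Q : AlgebraicClosure (v.adicCompletion ℚ)} {τ₀ g : absoluteGaloisGroup (v.adicCompletion ℚ)}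

/-- **Equal classes differ by an element of `B`**: if `[Ψu₁] = [Ψu₂]` in `M_∞/(g−1)M_∞` then
`u₁/u₂ = Qʲ·(gw/w)` for some `w ∈ T` (`w ≠ 0` fixed by `H_∞ ∩ Stab(t)`, `τ₀w·w ∈ Q^ℤ`): the difference is `(g−1)m`,
`m = Ψ(w)` by BRICK 18, and `Ψ` has kernel `Q^ℤ`. [cite: GreenbergLNM1716, §3 (pp. 87–93)] -/
theorem exists_div_eq_zpow_mul_coboundary_of_mk_eq_mk (hsurj : Function.Surjective Ψ)
    (hker : ∀ u : (AlgebraicClosure (v.adicCompletion ℚ))ˣ, Ψ (Additive.ofMul u) = 0 ↔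
      ∃ j : ℤ, (u : AlgebraicClosure (v.adicCompletion ℚ)) = Q ^ j)
    (hequiv' : ∀ (σ : absoluteGaloisGroup (v.adicCompletion ℚ)) (w w' : (AlgebraicClosure (v.adicCompletion ℚ))ˣ),
      (w' : AlgebraicClosure (v.adicCompletion ℚ)) = σ • (w : AlgebraicClosure (v.adicCompletion ℚ)) →
        σ • Ψ (Additive.ofMul w) = (if σ • t = t then (1 : ℤ) else -1) • Ψ (Additive.ofMul w'))
    (hQfix : ∀ σ : absoluteGaloisGroup (v.adicCompletion ℚ), σ • Q = Q) (hQ0 : Q ≠ 0)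
    (hQtor : ∀ j : ℤ, Q ^ j = 1 → j = 0) (hne : -t ≠ t) (hgt : g • t = t)
    (hτ₀ : τ₀ ∈ localSubgroup κ.kerSubgroup (v.adicCompletion ℚ)) (hτ₀t : τ₀ • t = -t)
    {u₁ u₂ : (AlgebraicClosure (v.adicCompletion ℚ))ˣ}
    {m₁ m₂ : FixedPoints.addSubgroup (localSubgroup κ.kerSubgroup (v.adicCompletion ℚ))
      (localPoints W (v.adicCompletion ℚ))}
    (hm₁ : (m₁ : localPoints W (v.adicCompletion ℚ)) = Ψ (Additive.ofMul u₁))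
    (hm₂ : (m₂ : localPoints W (v.adicCompletion ℚ)) = Ψ (Additive.ofMul u₂))
    (heq : (m₁ : FixedPoints.addSubgroup (localSubgroup κ.kerSubgroup (v.adicCompletion ℚ))
        (localPoints W (v.adicCompletion ℚ)) ⧸
        (subOne (localSubgroup κ.kerSubgroup (v.adicCompletion ℚ)) (localPoints W (v.adicCompletion ℚ)) g).range) = m₂) :
    ∃ (j : ℤ) (w : AlgebraicClosure (v.adicCompletion ℚ)), w ≠ 0 ∧
      (∀ h ∈ localSubgroup κ.kerSubgroup (v.adicCompletion ℚ), h • t = t → h • w = w) ∧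
      (∃ jw : ℤ, τ₀ • w * w = Q ^ jw) ∧
      (u₁ : AlgebraicClosure (v.adicCompletion ℚ)) / u₂ = Q ^ j * (g • w / w) := by
  set P := localPoints W (v.adicCompletion ℚ) with hP
  set M : AddSubgroup P :=
    FixedPoints.addSubgroup (localSubgroup κ.kerSubgroup (v.adicCompletion ℚ)) P with hM
  have memM : ∀ {a : P}, a ∈ M ↔ ∀ h ∈ localSubgroup κ.kerSubgroup (v.adicCompletion ℚ), h • a = a := fun {a} ↦ by
    rw [hM, FixedPoints.mem_addSubgroup]
    exact ⟨fun H h hh ↦ H ⟨h, hh⟩, fun H h ↦ H h h.2⟩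
  set d : M →+ M := subOne (localSubgroup κ.kerSubgroup (v.adicCompletion ℚ)) P g with hd
  rw [QuotientAddGroup.eq_iff_sub_mem] at heq
  obtain ⟨wM, hwM⟩ := heq
  obtain ⟨w, hwm, hwL, jw, hwj⟩ := exists_unit_of_mem_fixedPoints (κ := κ) v hsurj hker hequiv' hQfix hQ0 hQtor hne
    hτ₀ hτ₀t (memM.mp wM.2)
  set gw : (AlgebraicClosure (v.adicCompletion ℚ))ˣ :=
    Units.mk0 (g • (w : AlgebraicClosure (v.adicCompletion ℚ))) ((smul_ne_zero_iff_ne g).mpr w.ne_zero) with hgw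
  have hgΨ : g • Ψ (Additive.ofMul w) = Ψ (Additive.ofMul gw) := by
    have h1 := hequiv' g w gw rfl
    rw [if_pos hgt, one_zsmul] at h1
    exact h1
  have h3 : Ψ (Additive.ofMul (u₁ * u₂⁻¹)) = Ψ (Additive.ofMul (gw * w⁻¹)) := by
    rw [ofMul_mul, ofMul_inv, map_add, map_neg, ofMul_mul, ofMul_inv, map_add, map_neg, ← hgΨ, hwm, ← hm₁, ← hm₂,
      ← sub_eq_add_neg, ← sub_eq_add_neg]
    have h4 := congrArg (fun b : M ↦ (b : P)) hwM
    simp only [hd, AddSubgroupClass.coe_sub] at h4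
    exact h4.symm
  rw [tatePsi_eq_iff v hker] at h3
  obtain ⟨j, hj⟩ := h3
  refine ⟨j, w, w.ne_zero, hwL, ⟨jw, hwj⟩, ?_⟩
  rw [Units.val_mul, Units.val_inv_eq_inv_val, Units.val_mul, Units.val_inv_eq_inv_val, hgw, Units.val_mk0,
    ← div_eq_mul_inv, ← div_eq_mul_inv] at hj
  exact hj

/-- **`u^{2^k} ∈ B` ⟹ `2^k·[Ψu] = 0`** in `M_∞/(g−1)M_∞`: `2^k·Ψ(u) = Ψ(u^{2^k}) = Ψ(Qʲ·gw/w) = gΨ(w) − Ψ(w)`.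
[cite: GreenbergLNM1716, §3 (pp. 87–93)] -/
theorem nsmul_mk_eq_zero_of_pow_eq_zpow_mul_coboundary
    (hker : ∀ u : (AlgebraicClosure (v.adicCompletion ℚ))ˣ, Ψ (Additive.ofMul u) = 0 ↔
      ∃ j : ℤ, (u : AlgebraicClosure (v.adicCompletion ℚ)) = Q ^ j)
    (hequiv' : ∀ (σ : absoluteGaloisGroup (v.adicCompletion ℚ)) (w w' : (AlgebraicClosure (v.adicCompletion ℚ))ˣ),
      (w' : AlgebraicClosure (v.adicCompletion ℚ)) = σ • (w : AlgebraicClosure (v.adicCompletion ℚ)) →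
        σ • Ψ (Additive.ofMul w) = (if σ • t = t then (1 : ℤ) else -1) • Ψ (Additive.ofMul w'))
    (ht : ∀ σ : absoluteGaloisGroup (v.adicCompletion ℚ), σ • t = t ∨ σ • t = -t) (hne : -t ≠ t) (hgt : g • t = t)
    (hτ₀ : τ₀ ∈ localSubgroup κ.kerSubgroup (v.adicCompletion ℚ)) (hτ₀t : τ₀ • t = -t)
    {u : (AlgebraicClosure (v.adicCompletion ℚ))ˣ}
    {m : FixedPoints.addSubgroup (localSubgroup κ.kerSubgroup (v.adicCompletion ℚ)) (localPoints W (v.adicCompletion ℚ))}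
    (hm : (m : localPoints W (v.adicCompletion ℚ)) = Ψ (Additive.ofMul u)) {k : ℕ} {j jw : ℤ}
    {w : AlgebraicClosure (v.adicCompletion ℚ)} (hw0 : w ≠ 0)
    (hwL : ∀ h ∈ localSubgroup κ.kerSubgroup (v.adicCompletion ℚ), h • t = t → h • w = w)
    (hwj : τ₀ • w * w = Q ^ jw) (huk : (u : AlgebraicClosure (v.adicCompletion ℚ)) ^ 2 ^ k = Q ^ j * (g • w / w)) :
    2 ^ k • (m : FixedPoints.addSubgroup (localSubgroup κ.kerSubgroup (v.adicCompletion ℚ))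
        (localPoints W (v.adicCompletion ℚ)) ⧸
        (subOne (localSubgroup κ.kerSubgroup (v.adicCompletion ℚ)) (localPoints W (v.adicCompletion ℚ)) g).range) = 0 := by
  have hwu0 : (Units.mk0 w hw0 : AlgebraicClosure (v.adicCompletion ℚ)) = w := Units.val_mk0 _
  have hwM : ∀ h ∈ localSubgroup κ.kerSubgroup (v.adicCompletion ℚ),
      h • Ψ (Additive.ofMul (Units.mk0 w hw0)) = Ψ (Additive.ofMul (Units.mk0 w hw0)) :=
    apply_mem_fixedPoints (κ := κ) v hker hequiv' ht hne hτ₀ hτ₀t (x := Units.mk0 w hw0)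
      (fun h hh hht ↦ by rw [hwu0]; exact hwL h hh hht) (a := jw) (by rw [hwu0]; exact hwj)
  have hgΨ : g • Ψ (Additive.ofMul (Units.mk0 w hw0)) =
      Ψ (Additive.ofMul (Units.mk0 (g • w) ((smul_ne_zero_iff_ne g).mpr hw0))) := by
    have h1 := hequiv' g (Units.mk0 w hw0) (Units.mk0 (g • w) ((smul_ne_zero_iff_ne g).mpr hw0))
      (by rw [Units.val_mk0, Units.val_mk0])
    rw [if_pos hgt, one_zsmul] at h1
    exact h1
  -- `Ψ (u^{2^k}) = Ψ (gw / w)`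
  have hΨ : Ψ (Additive.ofMul (u ^ 2 ^ k)) =
      Ψ (Additive.ofMul (Units.mk0 (g • w) ((smul_ne_zero_iff_ne g).mpr hw0) * (Units.mk0 w hw0)⁻¹)) := by
    rw [tatePsi_eq_iff v hker]
    refine ⟨j, ?_⟩
    rw [Units.val_pow_eq_pow_val, huk, Units.val_mul, Units.val_inv_eq_inv_val, Units.val_mk0, Units.val_mk0,
      div_eq_mul_inv]
  rw [← QuotientAddGroup.mk_nsmul, QuotientAddGroup.eq_zero_iff]
  refine ⟨⟨Ψ (Additive.ofMul (Units.mk0 w hw0)), fun h ↦ hwM h h.2⟩, Subtype.ext ?_⟩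
  change g • Ψ (Additive.ofMul (Units.mk0 w hw0)) - Ψ (Additive.ofMul (Units.mk0 w hw0)) =
    ((2 ^ k • m : FixedPoints.addSubgroup (localSubgroup κ.kerSubgroup (v.adicCompletion ℚ))
      (localPoints W (v.adicCompletion ℚ))) : localPoints W (v.adicCompletion ℚ))
  rw [AddSubgroupClass.coe_nsmul, hm, ← map_nsmul, ← ofMul_pow, hΨ, ofMul_mul, ofMul_inv, map_add, map_neg, hgΨ,
    sub_eq_add_neg]

end Classes

end Summit.BirchSwinnertonDyer.BirchSwinnertonDyer.Theorems.MultTowerNS2LayerZero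

end
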